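import Mathlib
import Literature.Geometry.Lorentzian.LeviCivita
import Literature.Geometry.Lorentzian.Volume
import Literature.Geometry.Riemannian.IsotropicCurvature
import HarnessLib

/-!
# Named fact: closed 4-manifolds homotopy equivalent to `S¹ × S³` with almost nonnegative Ricci
curvature and a sectional floor fibre smoothly over the circle (Huang–Huang–Wang–Zhu 2026, Main Thm 1)

Grounder file (D-0014 named facts; grounder-ground-pool-g17-23, 2026-08-15) for the route
`SmoothPoincare4/OneHandleSplitting`: it is the planner's requested cite fact **F1** and the APEX
INPUT inlined verbatim as the third antecedent of the crux
`Summit.SmoothPoincare4.SmoothPoincare4.Theses.OneHandleSplitting.FibrationRecognition`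
(stmt-SmoothPoincare4-8117) and of `…OneHandleSplitting.Assembly` (stmt-SmoothPoincare4-8125).

## Source (held: paper:arxiv-2605.24380, read 2026-08-15, pp. 2–3 and 14)

H. Huang, X.-T. Huang, J. Wang, X. Zhu, *Fibrations, the First Betti Number, and Almost Nonnegative
Ricci Curvature*, arXiv:2605.24380 (May 2026), **Main Theorem 1** (p. 3), verbatim:

> "For any `n ∈ ℤ⁺`, `κ > 0`, there exists `δ(n,κ) > 0`, such that the following holds. Let `M` be
> an `n`-dimensional closed Riemannian manifold satisfying `diam(M)² Ric_M ≥ −δ(n)`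
> [(pinching-ricci), p. 2, with `δ = δ(n,κ)`], and `diam(M)² sec_M ≥ −κ`. Then `M` fibers over a
> `b₁(M)`-torus with connected fibers."

and (p. 14, proof): "we apply Theorem (eq-submetry) to construct a smooth map `F`, and obtain that
`dF` is non-degenerate due to the lower bound on sectional curvature. Consequently, `F` is a smooth
fiber bundle map." (The `b₁(M) = n` case is Colding 1997 / Cheeger–Colding 1997 Thm A.1.13; the
sectional upper bound of Yamaguchi 1988 and the finite cover of Yamaguchi 1991 are removed.)

## What is vendored (a SPECIALISATION, weaker than print)

`huangHuangWangZhu2026_fibresOverCircle_four` : the case `n = 4`, `M = P` a closed (compact,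
boundaryless: `ChartedSpace (EuclideanSpace ℝ (Fin 4))`) `C^∞` 4-manifold **homotopy equivalent to
`S¹ × S³`** (so `b₁(P) = 1` and the `b₁`-torus is the circle `S¹`; no Betti-number vocabulary is
needed), with the normalisation `diam(P) ≤ 1` (then `sec ≥ −κ`, `Ric ≥ −δ·g` imply the printed
scale-invariant hypotheses `diam²·sec ≥ −κ`, `diam²·Ric ≥ −δ` since `diam² ≤ 1`), and with the
conclusion rendered as: there is a `C^∞` map `f : P → S¹` which is a submersion (`mfderiv`
surjective everywhere) with connected fibres — which a smooth fibre bundle map over `S¹` with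
connected fibres is. Conventions (those of the route file, audited by the refuters 2026-08-15):
the metric is Mathlib's `Bundle.ContMDiffRiemannianMetric`; `sec ≥ −κ` is in Gram form
`−κ (g(X,X)g(Y,Y) − g(X,Y)²) ≤ Rm(X,Y,Y,X)` with `Rm = curvatureForm` of the Levi-Civita connection
(`Literature.Geometry.Lorentzian.PseudoRiemannianMetric.curvatureForm/leviCivita`, Koszul
connection; the binder `[HasLeviCivita]` is discharged in tree for every metric, so it is no extra
hypothesis); `Ric ≥ −δ·g` via `PseudoRiemannianMetric.ricci`; `diam ≤ 1` via
`Manifold.riemannianEDist` (which is `⊤` across components, so it also forces `P` connected).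
The constant `δ` depends on `κ` only (n = 4 fixed), exactly as printed (ineffective).

STATUS CAVEAT: the source is a May-2026 arXiv preprint (not yet refereed); the statement is vendored
as a `Prop` (nothing asserted) so that routes can take `(h : huangHuangWangZhu2026_fibresOverCircle_four)`
explicitly — the OneHandleSplitting route does exactly this (inlined), and its rank-2 crux
FibrationRecognition is `Perelman → Cerf → THIS → (recognition of S¹×S³)`.

Grounds `Summit.SmoothPoincare4.SmoothPoincare4.Theses.OneHandleSplitting.FibrationRecognition`
(third antecedent, letter for letter) and `…OneHandleSplitting.Assembly`.

## References

* H. Huang, X.-T. Huang, J. Wang, X. Zhu, arXiv:2605.24380 (2026), Main Theorem 1 (p. 3), proof p. 14.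
  [HuangHuangWangZhu2026]
* T. Colding, Ann. of Math. 145 (1997); J. Cheeger, T. Colding, J. Differential Geom. 46 (1997),
  Thm A.1.13 (the `b₁ = n` model). [Colding1997] [CheegerColding1997]
-/

noncomputable section

open scoped Manifold ContDiff

namespace Literature.Geometry.Riemannian

/-- NAMED FACT (Huang–Huang–Wang–Zhu 2026, arXiv:2605.24380, **Main Theorem 1** at `n = 4`,
specialised to closed smooth 4-manifolds homotopy equivalent to `S¹ × S³`, i.e. `b₁ = 1`): for every
`κ > 0` there is `δ > 0` such that every closed `C^∞` 4-manifold `P ≃ₕ S¹ × S³` carrying a `C^∞`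
Riemannian metric `g` with `diam(P,g) ≤ 1`, `sec_g ≥ −κ` (Gram form) and `Ric_g ≥ −δ·g` admits a
smooth submersion `f : P → S¹` with connected fibres ("`M` fibers over a `b₁(M)`-torus with
connected fibers"; "`F` is a smooth fiber bundle map", p. 14). Weaker than print (n = 4, b₁ = 1,
diam-normalised, submersion-with-connected-fibres instead of fibre bundle). Preprint (May 2026).
Users take `(h : huangHuangWangZhu2026_fibresOverCircle_four)`; grounds
`Summit.SmoothPoincare4.SmoothPoincare4.Theses.OneHandleSplitting.FibrationRecognition`.
[cite: HuangHuangWangZhu2026, Main Theorem 1 (arXiv:2605.24380 p. 3) and proof p. 14] -/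
def huangHuangWangZhu2026_fibresOverCircle_four : Prop :=
  ∀ κ : ℝ, 0 < κ → ∃ δ : ℝ, 0 < δ ∧ ∀ (P : Type) [TopologicalSpace P] [T2Space P]
    [SecondCountableTopology P] [ChartedSpace (EuclideanSpace ℝ (Fin 4)) P] [IsManifold (𝓡 4) ∞ P]
    [CompactSpace P],
    ContinuousMap.HomotopyEquiv P ((Metric.sphere (0 : EuclideanSpace ℝ (Fin 2)) 1) × (Metric.sphere (0 : EuclideanSpace ℝ (Fin 4)) 1)) →
    ∀ (g : Bundle.ContMDiffRiemannianMetric (𝓡 4) ∞ (EuclideanSpace ℝ (Fin 4)) (TangentSpace (𝓡 4) : P → Type _))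
      [(Literature.Geometry.Lorentzian.PseudoRiemannianMetric.ofRiemannian g).HasLeviCivita],
      (open Bundle in letI : Bundle.RiemannianBundle (fun x : P ↦ TangentSpace (𝓡 4) x) :=
        ⟨g.toContinuousRiemannianMetric.toRiemannianMetric⟩; ∀ x y : P, Manifold.riemannianEDist (𝓡 4) x y ≤ 1) →
      (∀ (x : P) (X Y : TangentSpace (𝓡 4) x),
        -κ * (g.inner x X X * g.inner x Y Y - g.inner x X Y ^ 2) ≤
          (Literature.Geometry.Lorentzian.PseudoRiemannianMetric.ofRiemannian g).curvatureForm
            (Literature.Geometry.Lorentzian.PseudoRiemannianMetric.ofRiemannian g).leviCivita x X Y Y X) →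
      (∀ (x : P) (w : TangentSpace (𝓡 4) x),
        -δ * g.inner x w w ≤ (Literature.Geometry.Lorentzian.PseudoRiemannianMetric.ofRiemannian g).ricci x w w) →
      ∃ f : P → (Metric.sphere (0 : EuclideanSpace ℝ (Fin 2)) 1),
        ContMDiff (𝓡 4) (𝓡 1) ∞ f ∧ (∀ x : P, Function.Surjective (mfderiv (𝓡 4) (𝓡 1) f x)) ∧
          ∀ θ : (Metric.sphere (0 : EuclideanSpace ℝ (Fin 2)) 1), IsConnected (f ⁻¹' {θ})

end Literature.Geometry.Riemannian

end
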